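import Mathlib
import HarnessLib
import Literature.MathematicalPhysics.StatisticalMechanics.RenormalisationMapRemainderTwoLarge
import Literature.MathematicalPhysics.StatisticalMechanics.RenormalisationMapRemainderThree
import Literature.MathematicalPhysics.StatisticalMechanics.RenormalisationMapRemainderFour
import Literature.MathematicalPhysics.StatisticalMechanics.NextHamiltonianBounds

/-!
# The remainder sums `Σ₂ᴸ, Σ₃, Σ₄` of the renormalisation map are Lipschitz — final form (torus data, `H̃ = A_kH + B_kK`)

CH12-PLAN §5 (e3) of the crux line `gnv` (stub `stub_gnvOfFrd`): the Lipschitz estimate of the renormalisation map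
`S(H,K) = K_{k+1}` of [ABKM19] Definition 6.5 on the small ball, for the concrete torus data.  The remainder
sums of `GradientRG.nextKStep_sub_opC_eq` were bounded with the extracted Hamiltonians `H̃, H̃'` as free
parameters (RenormalisationMapRemainderOne / TwoLarge / Three / Four); here `H̃ = nextH D H K = A_kH + B_kK`
and NextHamiltonianBounds (`‖H̃‖ ≤ 2b + v`, `‖H̃ − H̃'‖ ≤ 2‖H − H'‖ + v_Δ`, `v = C_{8.7}CA_𝒫A^{−1}`,
`v_Δ = C_{8.7}C_ΔA_𝒫A^{−1}`) are substituted, so that every bound is expressed through `‖H‖,‖H'‖ ≤ b`,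
`‖H − H'‖`, `‖K‖,‖K'‖ ≤ C`, `‖K − K'‖ ≤ C_Δ`.

* **`tayNormLE_remainderTwoLarge_sub_abkm_final`**, **`tayNormLE_remainderThree_sub_abkm_final`**,
  **`tayNormLE_remainderFour_sub_abkm_final`** — the bounds of RenormalisationMapRemainderTwoLarge / Three / Four
  with `‖H̃ − H̃'‖ ≤ 2‖H−H'‖ + v_Δ` and `‖H̃‖,‖H̃'‖ ≤ 2b + v` substituted (monotonicity, `gcongr`).

Everything is proved; no named fact.

## References
* S. Adams, S. Buchholz, R. Kotecký, S. Müller, arXiv:1910.13564, Theorem 6.8, Lemma 9.6, Lemma 10.1,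
  Lemma 10.2, Ch. 12 (12.4) [AdamsBuchholzKoteckyMuller2019].
-/

noncomputable section

namespace Literature.MathematicalPhysics.StatisticalMechanics.GradientRG

open scoped BigOperators Classical
open Finset MeasureTheory
open Literature.MathematicalPhysics.StatisticalMechanics.TorusPolymer
  (IsPolymer blocks polys bprod blockOf thicken reblock boxCorner mem_polys mem_blocks numBlocks isPolymer_blockOf
    card_blocks_eq_numBlocks blocks_blockOf empty_mem_polys closure)
open Literature.Barriers.CriticalPhenomena.LongRangePhi4.Polymer (IsConn components)
open Literature.MathematicalPhysics.StatisticalMechanics.GradientFRD (iterDiff)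
open Literature.MathematicalPhysics.QuantumFieldTheory

variable {d M : ℕ} [NeZero M]

/-- **`Σ` (TwoLarge) in final form**: `tayNormLE_remainderTwoLarge_sub_abkm` for `H̃ = nextH D H K`, `H̃' = nextH D H' K'`, with
`‖H̃ − H̃'‖ ≤ 2‖H−H'‖ + v_Δ`, `‖H̃‖,‖H̃'‖ ≤ 2b + v` substituted (NextHamiltonianBounds).
[cite: AdamsBuchholzKoteckyMuller2019, Theorem 6.8 / Lemma 9.6 (proof, first order)] -/
theorem tayNormLE_remainderTwoLarge_sub_abkm_final {L N Mord R n p r₀ : ℕ} {θbar lam μ δ₁ δ₀ A𝒫 h A : ℝ}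
    {𝒞 : ℕ → (Fin d → ZMod M) → ℝ} (hd : 3 ≤ d) (hn : 2 ≤ n) (hLodd : Odd L) (hL : 2 ^ (d + 3) + 16 * R ≤ L)
    (hR2 : 2 ≤ R) (hM : M = L ^ N) {k : ℕ} (hkN : k + 1 ≤ N)
    (hp1 : d / 2 + 1 ≤ p) (hpR : p ≤ R) (hMord : d / 2 + 1 ≤ Mord) (hr₀2 : 2 ≤ r₀)
    (hθbar : 0 < θbar) (hlam : 0 < lam)
    (hB : AbkmWeightBounds L N Mord R n θbar lam μ δ₁ δ₀ A𝒫 𝒞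
      (abkmWeightData L N Mord R θbar (schedDelta δ₀ δ₁ N) 𝒞))
    (hδ₀ : 0 < δ₀) (hδ₁ : 0 < δ₁) (hh : 0 < h) (hh0 : hZeroSq d R δ₀ δ₁ ≤ h ^ 2)
    {Cα : (Fin d → ℕ) → ℝ}
    (hCα : ∀ j, 1 ≤ j → j ≤ N + 1 → ∀ θ' : Fin d → ℕ, ∑ i, θ' i ≤ n →
      ∀ x, |iterDiff θ' (𝒞 j) x| ≤ Cα θ' / (L : ℝ) ^ ((j - 1) * (d - 2 + ∑ i, θ' i)))
    (hh2 : secondDiffConst Cα ≤ h ^ 2) (hA𝒫 : 0 ≤ A𝒫) (hA1 : 1 ≤ A)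
    (D : StepData d M) (hD𝒞 : D.𝒞 = 𝒞 (k + 1))
    {x₀ : Fin d → ZMod M} (hB₀ : D.B₀ = blockOf (L ^ k) x₀) (hc₀ : D.c₀ = boxCorner (L ^ k) (starRad R L d k) x₀)
    {U : Finset (Fin d → ZMod M)} (hU : IsPolymer (L ^ (k + 1)) U)
    {H H' : RelevantHamiltonian ℂ d} {b : ℝ}
    (hH : hamNorm (fieldWt h (L : ℝ) d k) ((L : ℝ) ^ k) (L ^ (d * k)) H ≤ b)
    (hH' : hamNorm (fieldWt h (L : ℝ) d k) ((L : ℝ) ^ k) (L ^ (d * k)) H' ≤ b) (hb : b ≤ 1 / 64)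
    {K K' : Finset (Fin d → ZMod M) → ((Fin d → ZMod M) → ℝ) → ℂ} {C CΔ : ℝ} (hC : 0 ≤ C) (hCΔ : 0 ≤ CΔ)
    (hK : WeakNormLE (abkmNormParams L N Mord R p r₀ h θbar A (schedDelta δ₀ δ₁ N) 𝒞) k K C)
    (hK' : WeakNormLE (abkmNormParams L N Mord R p r₀ h θbar A (schedDelta δ₀ δ₁ N) 𝒞) k K' C)
    (hΔ : WeakNormLE (abkmNormParams L N Mord R p r₀ h θbar A (schedDelta δ₀ δ₁ N) 𝒞) k (K - K') CΔ)
    (hKfac : Factorises (L ^ k) K) (hK0 : ∀ φ, K ∅ φ = 1) (hK'fac : Factorises (L ^ k) K') (hK'0 : ∀ φ, K' ∅ φ = 1)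
    (hKd : ∀ Y, ContDiff ℝ r₀ (K Y)) (hK'd : ∀ Y, ContDiff ℝ r₀ (K' Y))
    (hKloc : ∀ Y, IsPolymer (L ^ k) Y → IsConn Y → IsGaugeLocal ((abkmNormParams L N Mord R p r₀ h θbar A (schedDelta δ₀ δ₁ N) 𝒞).gauge k Y) (K Y))
    (hK'loc : ∀ Y, IsPolymer (L ^ k) Y → IsConn Y → IsGaugeLocal ((abkmNormParams L N Mord R p r₀ h θbar A (schedDelta δ₀ δ₁ N) 𝒞).gauge k Y) (K' Y))
    (hv : pi2BoundConst d (((2 * R + 2 : ℕ) : ℝ) + ((d / 2 + 1 : ℕ) : ℝ)) * (C * A𝒫 * A⁻¹) ≤ 1 / 64)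
    {ω : ℝ}
    (hω1 : 8 * Real.exp (1 / 4) * (2 * b + pi2BoundConst d (((2 * R + 2 : ℕ) : ℝ) + ((d / 2 + 1 : ℕ) : ℝ)) * (C * A𝒫 * A⁻¹)) + 16 * Real.exp (3 / 8) * (2 * hamNorm (fieldWt h (L : ℝ) d k) ((L : ℝ) ^ k) (L ^ (d * k)) (H - H') + pi2BoundConst d (((2 * R + 2 : ℕ) : ℝ) + ((d / 2 + 1 : ℕ) : ℝ)) * (CΔ * A𝒫 * A⁻¹)) ≤ ω)
    (hω2 : 8 * Real.exp (1 / 4) * b + 16 * Real.exp (3 / 8) * hamNorm (fieldWt h (L : ℝ) d k) ((L : ℝ) ^ k) (L ^ (d * k)) (H - H') ≤ ω)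
    (hω3 : C + CΔ ≤ ω) (hωA : ω * A ^ 2 ≤ 1)
    {κ : ℝ}
    (hκ1 : 1 + Real.exp (1 / 4) + 16 * Real.exp (3 / 8) * (2 * hamNorm (fieldWt h (L : ℝ) d k) ((L : ℝ) ^ k) (L ^ (d * k)) (H - H') + pi2BoundConst d (((2 * R + 2 : ℕ) : ℝ) + ((d / 2 + 1 : ℕ) : ℝ)) * (CΔ * A𝒫 * A⁻¹)) ≤ κ) :
    TayNormLE ((abkmNormParams L N Mord R p r₀ h θbar A (schedDelta δ₀ δ₁ N) 𝒞).gauge (k + 1) U) r₀ ((abkmWeightData L N Mord R θbar (schedDelta δ₀ δ₁ N) 𝒞).weight (k + 1) U)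
      (fun φ => ∑ X ∈ largePartIndex (L ^ k) L U,
        (bprod (L ^ k) (fun B => expNegH (nextH D H K) B φ) (U \ X) * bprod (L ^ k) (fun B => expNegH (-(nextH D H K)) B φ) (X \ U) *
            (fluct (𝒞 (k + 1)) (polyP2 (L ^ k) H K X) φ + bprod (L ^ k) (fun B => 1 - expNegH (nextH D H K) B φ) X) -
          bprod (L ^ k) (fun B => expNegH (nextH D H' K') B φ) (U \ X) * bprod (L ^ k) (fun B => expNegH (-(nextH D H' K')) B φ) (X \ U) *
            (fluct (𝒞 (k + 1)) (polyP2 (L ^ k) H' K' X) φ + bprod (L ^ k) (fun B => 1 - expNegH (nextH D H' K') B φ) X)))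
      (κ ^ (blocks (L ^ k) U).card * ((3 * (16 * Real.exp (3 / 8) * (2 * hamNorm (fieldWt h (L : ℝ) d k) ((L : ℝ) ^ k) (L ^ (d * k)) (H - H') + pi2BoundConst d (((2 * R + 2 : ℕ) : ℝ) + ((d / 2 + 1 : ℕ) : ℝ)) * (CΔ * A𝒫 * A⁻¹))) + 16 * Real.exp (3 / 8) * hamNorm (fieldWt h (L : ℝ) d k) ((L : ℝ) ^ k) (L ^ (d * k)) (H - H') + CΔ) * (ω * A ^ 4)) * (((2 * (2 * κ * max 1 A𝒫)) ^ ((2 ^ (d + 1) + 2) ^ d * L ^ d) * (4 : ℝ) ^ ((2 ^ (d + 1) + 2) ^ d * L ^ d)) ^ (blocks (L * L ^ k) U).card * A ^ (-((1 + 1 / ((2 * (2 ^ d + 1) + 6 : ℝ) ^ d)) * (blocks (L * L ^ k) U).card) : ℝ)) +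
          κ ^ (blocks (L ^ k) U).card * (2 * (16 * Real.exp (3 / 8) * (2 * hamNorm (fieldWt h (L : ℝ) d k) ((L : ℝ) ^ k) (L ^ (d * k)) (H - H') + pi2BoundConst d (((2 * R + 2 : ℕ) : ℝ) + ((d / 2 + 1 : ℕ) : ℝ)) * (CΔ * A𝒫 * A⁻¹))) + CΔ) * (((2 * κ * max 1 A𝒫) ^ ((2 ^ (d + 1) + 2) ^ d * L ^ d) * (2 : ℝ) ^ ((2 ^ (d + 1) + 2) ^ d * L ^ d)) ^ (blocks (L * L ^ k) U).card * A ^ (-((1 + 1 / ((2 * (2 ^ d + 1) + 6 : ℝ) ^ d)) * (blocks (L * L ^ k) U).card) : ℝ))) := by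
  set P := abkmNormParams L N Mord R p r₀ h θbar A (schedDelta δ₀ δ₁ N) 𝒞 with hP
  set W := abkmWeightData L N Mord R θbar (schedDelta δ₀ δ₁ N) 𝒞 with hW
  have hd2 : 2 ≤ d := by omega
  have hL0 : (0 : ℝ) < L := by exact_mod_cast hLodd.pos
  have hA0 : 0 < A := by linarith
  have hk1 : k + 1 ≤ N + 1 := by omega
  have h𝔥 : 0 < fieldWt h (L : ℝ) d k := fieldWt_pos hh hL0 d k
  have hRk : (0 : ℝ) < (L : ℝ) ^ k := by positivity
  have hnn : ∀ G : RelevantHamiltonian ℂ d, 0 ≤ hamNorm (fieldWt h (L : ℝ) d k) ((L : ℝ) ^ k) (L ^ (d * k)) G :=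
    fun G => hamNorm_nonneg h𝔥.le hRk.le _ _
  have hb0 : 0 ≤ b := (hnn H).trans hH
  have hC87_0 : 0 ≤ pi2BoundConst d (((2 * R + 2 : ℕ) : ℝ) + ((d / 2 + 1 : ℕ) : ℝ)) := pi2BoundConst_nonneg d (by positivity)
  have hAinv : 0 ≤ A⁻¹ := inv_nonneg.2 hA0.le
  have hv0 : 0 ≤ pi2BoundConst d (((2 * R + 2 : ℕ) : ℝ) + ((d / 2 + 1 : ℕ) : ℝ)) * (C * A𝒫 * A⁻¹) := by positivity
  have hvΔ0 : 0 ≤ pi2BoundConst d (((2 * R + 2 : ℕ) : ℝ) + ((d / 2 + 1 : ℕ) : ℝ)) * (CΔ * A𝒫 * A⁻¹) := by positivity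
  have hnHH0 := hnn (H - H')
  have he38 : 0 ≤ 16 * Real.exp (3 / 8) := by positivity
  have he14 : 0 ≤ 8 * Real.exp (1 / 4) := by positivity
  have hHt0 := hamNorm_nextH_abkm_le hd2 hn hLodd hL hM hkN hp1 hpR hr₀2 hθbar hlam hB hh hCα hh2 hA1 D hD𝒞 hB₀ hc₀ H
    hC hK hKd hKloc
  have hHt'0 := hamNorm_nextH_abkm_le hd2 hn hLodd hL hM hkN hp1 hpR hr₀2 hθbar hlam hB hh hCα hh2 hA1 D hD𝒞 hB₀ hc₀ H'
    hC hK' hK'd hK'loc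
  have hΔle := hamNorm_nextH_sub_abkm_le hd2 hn hLodd hL hM hkN hp1 hpR hr₀2 hθbar hlam hB hh hCα hh2 hA1 D hD𝒞 hB₀ hc₀
    H H' hC hC hCΔ hK hK' hΔ hKd hK'd hKloc hK'loc
  have hHt : hamNorm (fieldWt h (L : ℝ) d k) ((L : ℝ) ^ k) (L ^ (d * k)) (nextH D H K) ≤ (2 * b + pi2BoundConst d (((2 * R + 2 : ℕ) : ℝ) + ((d / 2 + 1 : ℕ) : ℝ)) * (C * A𝒫 * A⁻¹)) := by
    linarith [hHt0, hH]
  have hHt' : hamNorm (fieldWt h (L : ℝ) d k) ((L : ℝ) ^ k) (L ^ (d * k)) (nextH D H' K') ≤ (2 * b + pi2BoundConst d (((2 * R + 2 : ℕ) : ℝ) + ((d / 2 + 1 : ℕ) : ℝ)) * (C * A𝒫 * A⁻¹)) := by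
    linarith [hHt'0, hH']
  have hτ : (2 * b + pi2BoundConst d (((2 * R + 2 : ℕ) : ℝ) + ((d / 2 + 1 : ℕ) : ℝ)) * (C * A𝒫 * A⁻¹)) ≤ 1 / 16 := by linarith [hb, hv]
  have hτ0 : 0 ≤ (2 * b + pi2BoundConst d (((2 * R + 2 : ℕ) : ℝ) + ((d / 2 + 1 : ℕ) : ℝ)) * (C * A𝒫 * A⁻¹)) := by positivity
  have hΔt : 16 * Real.exp (3 / 8) * hamNorm (fieldWt h (L : ℝ) d k) ((L : ℝ) ^ k) (L ^ (d * k)) (nextH D H K - nextH D H' K') ≤ 16 * Real.exp (3 / 8) * (2 * hamNorm (fieldWt h (L : ℝ) d k) ((L : ℝ) ^ k) (L ^ (d * k)) (H - H') + pi2BoundConst d (((2 * R + 2 : ℕ) : ℝ) + ((d / 2 + 1 : ℕ) : ℝ)) * (CΔ * A𝒫 * A⁻¹)) :=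
    mul_le_mul_of_nonneg_left hΔle he38
  have hκ : 1 + Real.exp (1 / 4) + 16 * Real.exp (3 / 8) * hamNorm (fieldWt h (L : ℝ) d k) ((L : ℝ) ^ k) (L ^ (d * k)) (nextH D H K - nextH D H' K') ≤ κ := by
    linarith [hΔt, hκ1]
  have hκ0 : 0 ≤ κ := by
    have e1 : 0 ≤ 16 * Real.exp (3 / 8) * hamNorm (fieldWt h (L : ℝ) d k) ((L : ℝ) ^ k) (L ^ (d * k)) (nextH D H K - nextH D H' K') := mul_nonneg he38 (hnn _)
    linarith [hκ, Real.exp_pos (1 / 4)]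
  have hκm0 : 0 ≤ κ ^ (blocks (L ^ k) U).card := pow_nonneg hκ0 _
  have hDP0 : 0 ≤ 16 * Real.exp (3 / 8) * (2 * hamNorm (fieldWt h (L : ℝ) d k) ((L : ℝ) ^ k) (L ^ (d * k)) (H - H') + pi2BoundConst d (((2 * R + 2 : ℕ) : ℝ) + ((d / 2 + 1 : ℕ) : ℝ)) * (CΔ * A𝒫 * A⁻¹)) := by positivity
  have hH16 : hamNorm (fieldWt h (L : ℝ) d k) ((L : ℝ) ^ k) (L ^ (d * k)) H ≤ 1 / 16 := by linarith [hH, hb]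
  have hH'16 : hamNorm (fieldWt h (L : ℝ) d k) ((L : ℝ) ^ k) (L ^ (d * k)) H' ≤ 1 / 16 := by linarith [hH', hb]
  have hθω : 8 * Real.exp (1 / 4) * (2 * b + pi2BoundConst d (((2 * R + 2 : ℕ) : ℝ) + ((d / 2 + 1 : ℕ) : ℝ)) * (C * A𝒫 * A⁻¹)) + 16 * Real.exp (3 / 8) * hamNorm (fieldWt h (L : ℝ) d k) ((L : ℝ) ^ k) (L ^ (d * k)) (nextH D H K - nextH D H' K') ≤ ω := by
    linarith [hΔt, hω1]
  have hbω : 8 * Real.exp (1 / 4) * hamNorm (fieldWt h (L : ℝ) d k) ((L : ℝ) ^ k) (L ^ (d * k)) H ≤ ω := by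
    have e1 := mul_le_mul_of_nonneg_left hH he14
    have e2 : 0 ≤ 16 * Real.exp (3 / 8) * hamNorm (fieldWt h (L : ℝ) d k) ((L : ℝ) ^ k) (L ^ (d * k)) (H - H') := by positivity
    linarith [hω2]
  have hb'ω : 8 * Real.exp (1 / 4) * hamNorm (fieldWt h (L : ℝ) d k) ((L : ℝ) ^ k) (L ^ (d * k)) H' + 16 * Real.exp (3 / 8) * hamNorm (fieldWt h (L : ℝ) d k) ((L : ℝ) ^ k) (L ^ (d * k)) (H - H') ≤ ω := by
    have e1 := mul_le_mul_of_nonneg_left hH' he14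
    linarith [hω2]
  have hω0 : 0 ≤ ω := le_trans (by positivity) hω3
  have hωA4 : 0 ≤ ω * A ^ 4 := by positivity
  have hmax : 0 ≤ 2 * κ * max 1 A𝒫 := by positivity
  have hgain0 : 0 ≤ A ^ (-((1 + 1 / ((2 * (2 ^ d + 1) + 6 : ℝ) ^ d)) * (blocks (L * L ^ k) U).card) : ℝ) := Real.rpow_nonneg hA0.le _
  have hY3 : 0 ≤ ((2 * (2 * κ * max 1 A𝒫)) ^ ((2 ^ (d + 1) + 2) ^ d * L ^ d) * (4 : ℝ) ^ ((2 ^ (d + 1) + 2) ^ d * L ^ d)) ^ (blocks (L * L ^ k) U).card * A ^ (-((1 + 1 / ((2 * (2 ^ d + 1) + 6 : ℝ) ^ d)) * (blocks (L * L ^ k) U).card) : ℝ) := by positivity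
  have hY2 : 0 ≤ ((2 * κ * max 1 A𝒫) ^ ((2 ^ (d + 1) + 2) ^ d * L ^ d) * (2 : ℝ) ^ ((2 ^ (d + 1) + 2) ^ d * L ^ d)) ^ (blocks (L * L ^ k) U).card * A ^ (-((1 + 1 / ((2 * (2 ^ d + 1) + 6 : ℝ) ^ d)) * (blocks (L * L ^ k) U).card) : ℝ) := by positivity
  have h2 := tayNormLE_remainderTwoLarge_sub_abkm (p := p) (r₀ := r₀) hd hLodd hL hR2 hM hkN hp1 hMord hθbar hlam hB hδ₀
    hδ₁ hh hh0 hA𝒫 hA1 hU hHt hHt' hτ hH16 hH'16 hC hCΔ hK hK' hΔ hKfac hK0 hKd hK'fac hK'0 hK'd hKloc hK'loc hθω hbω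
    hb'ω hω3 hωA hκ
  exact h2.mono
    (by
      gcongr) (fun φ => (W.weight_pos (k + 1) U φ).le)

/-- **`Σ` (Three) in final form**: `tayNormLE_remainderThree_sub_abkm` for `H̃ = nextH D H K`, `H̃' = nextH D H' K'`, with
`‖H̃ − H̃'‖ ≤ 2‖H−H'‖ + v_Δ`, `‖H̃‖,‖H̃'‖ ≤ 2b + v` substituted (NextHamiltonianBounds).
[cite: AdamsBuchholzKoteckyMuller2019, Theorem 6.8 / Lemma 9.6 (proof, first order)] -/
theorem tayNormLE_remainderThree_sub_abkm_final {L N Mord R n p r₀ : ℕ} {θbar lam μ δ₁ δ₀ A𝒫 h A : ℝ}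
    {𝒞 : ℕ → (Fin d → ZMod M) → ℝ} (hd : 3 ≤ d) (hn : 2 ≤ n) (hLodd : Odd L) (hL : 2 ^ (d + 3) + 16 * R ≤ L)
    (hR2 : 2 ≤ R) (hM : M = L ^ N) {k : ℕ} (hkN : k + 1 ≤ N)
    (hp1 : d / 2 + 1 ≤ p) (hpR : p ≤ R) (hMord : d / 2 + 1 ≤ Mord) (hr₀2 : 2 ≤ r₀)
    (hθbar : 0 < θbar) (hlam : 0 < lam)
    (hB : AbkmWeightBounds L N Mord R n θbar lam μ δ₁ δ₀ A𝒫 𝒞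
      (abkmWeightData L N Mord R θbar (schedDelta δ₀ δ₁ N) 𝒞))
    (hδ₀ : 0 < δ₀) (hδ₁ : 0 < δ₁) (hh : 0 < h) (hh0 : hZeroSq d R δ₀ δ₁ ≤ h ^ 2)
    {Cα : (Fin d → ℕ) → ℝ}
    (hCα : ∀ j, 1 ≤ j → j ≤ N + 1 → ∀ θ' : Fin d → ℕ, ∑ i, θ' i ≤ n →
      ∀ x, |iterDiff θ' (𝒞 j) x| ≤ Cα θ' / (L : ℝ) ^ ((j - 1) * (d - 2 + ∑ i, θ' i)))
    (hh2 : secondDiffConst Cα ≤ h ^ 2) (hA𝒫 : 0 ≤ A𝒫) (hA1 : 1 ≤ A)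
    (D : StepData d M) (hD𝒞 : D.𝒞 = 𝒞 (k + 1))
    {x₀ : Fin d → ZMod M} (hB₀ : D.B₀ = blockOf (L ^ k) x₀) (hc₀ : D.c₀ = boxCorner (L ^ k) (starRad R L d k) x₀)
    {U : Finset (Fin d → ZMod M)} (hU : IsPolymer (L ^ (k + 1)) U)
    (hUne : U.Nonempty)
    {H H' : RelevantHamiltonian ℂ d} {b : ℝ}
    (hH : hamNorm (fieldWt h (L : ℝ) d k) ((L : ℝ) ^ k) (L ^ (d * k)) H ≤ b)
    (hH' : hamNorm (fieldWt h (L : ℝ) d k) ((L : ℝ) ^ k) (L ^ (d * k)) H' ≤ b) (hb : b ≤ 1 / 64)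
    {K K' : Finset (Fin d → ZMod M) → ((Fin d → ZMod M) → ℝ) → ℂ} {C CΔ : ℝ} (hC : 0 ≤ C) (hCΔ : 0 ≤ CΔ)
    (hK : WeakNormLE (abkmNormParams L N Mord R p r₀ h θbar A (schedDelta δ₀ δ₁ N) 𝒞) k K C)
    (hK' : WeakNormLE (abkmNormParams L N Mord R p r₀ h θbar A (schedDelta δ₀ δ₁ N) 𝒞) k K' C)
    (hΔ : WeakNormLE (abkmNormParams L N Mord R p r₀ h θbar A (schedDelta δ₀ δ₁ N) 𝒞) k (K - K') CΔ)
    (hKfac : Factorises (L ^ k) K) (hK0 : ∀ φ, K ∅ φ = 1) (hK'fac : Factorises (L ^ k) K') (hK'0 : ∀ φ, K' ∅ φ = 1)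
    (hKd : ∀ Y, ContDiff ℝ r₀ (K Y)) (hK'd : ∀ Y, ContDiff ℝ r₀ (K' Y))
    (hKloc : ∀ Y, IsPolymer (L ^ k) Y → IsConn Y → IsGaugeLocal ((abkmNormParams L N Mord R p r₀ h θbar A (schedDelta δ₀ δ₁ N) 𝒞).gauge k Y) (K Y))
    (hK'loc : ∀ Y, IsPolymer (L ^ k) Y → IsConn Y → IsGaugeLocal ((abkmNormParams L N Mord R p r₀ h θbar A (schedDelta δ₀ δ₁ N) 𝒞).gauge k Y) (K' Y))
    (hv : pi2BoundConst d (((2 * R + 2 : ℕ) : ℝ) + ((d / 2 + 1 : ℕ) : ℝ)) * (C * A𝒫 * A⁻¹) ≤ 1 / 64)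
    {ω : ℝ}
    (hω1 : 8 * Real.exp (1 / 4) * (2 * b + pi2BoundConst d (((2 * R + 2 : ℕ) : ℝ) + ((d / 2 + 1 : ℕ) : ℝ)) * (C * A𝒫 * A⁻¹)) + 16 * Real.exp (3 / 8) * (2 * hamNorm (fieldWt h (L : ℝ) d k) ((L : ℝ) ^ k) (L ^ (d * k)) (H - H') + pi2BoundConst d (((2 * R + 2 : ℕ) : ℝ) + ((d / 2 + 1 : ℕ) : ℝ)) * (CΔ * A𝒫 * A⁻¹)) ≤ ω)
    (hω2 : 8 * Real.exp (1 / 4) * b + 16 * Real.exp (3 / 8) * hamNorm (fieldWt h (L : ℝ) d k) ((L : ℝ) ^ k) (L ^ (d * k)) (H - H') ≤ ω)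
    (hω3 : C + CΔ ≤ ω) (hωA : ω * A ^ 2 ≤ 1)
    {κ : ℝ}
    (hκ1 : 1 + Real.exp (1 / 4) + 16 * Real.exp (3 / 8) * (2 * hamNorm (fieldWt h (L : ℝ) d k) ((L : ℝ) ^ k) (L ^ (d * k)) (H - H') + pi2BoundConst d (((2 * R + 2 : ℕ) : ℝ) + ((d / 2 + 1 : ℕ) : ℝ)) * (CΔ * A𝒫 * A⁻¹)) ≤ κ) :
    TayNormLE ((abkmNormParams L N Mord R p r₀ h θbar A (schedDelta δ₀ δ₁ N) 𝒞).gauge (k + 1) U) r₀ ((abkmWeightData L N Mord R θbar (schedDelta δ₀ δ₁ N) 𝒞).weight (k + 1) U)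
      (fun φ => ∑ X ∈ ((polys (L ^ k) univ).filter (fun X => reblock (L ^ k) (L * L ^ k) X = U)).filter
          (fun X => ¬ IsConn X),
        (bprod (L ^ k) (fun B => expNegH (nextH D H K) B φ) (U \ X) * bprod (L ^ k) (fun B => expNegH (-(nextH D H K)) B φ) (X \ U) *
            (fluct (𝒞 (k + 1)) (polyP2 (L ^ k) H K X) φ + bprod (L ^ k) (fun B => 1 - expNegH (nextH D H K) B φ) X) -
          bprod (L ^ k) (fun B => expNegH (nextH D H' K') B φ) (U \ X) * bprod (L ^ k) (fun B => expNegH (-(nextH D H' K')) B φ) (X \ U) *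
            (fluct (𝒞 (k + 1)) (polyP2 (L ^ k) H' K' X) φ + bprod (L ^ k) (fun B => 1 - expNegH (nextH D H' K') B φ) X)))
      (κ ^ (blocks (L ^ k) U).card * ((3 * (16 * Real.exp (3 / 8) * (2 * hamNorm (fieldWt h (L : ℝ) d k) ((L : ℝ) ^ k) (L ^ (d * k)) (H - H') + pi2BoundConst d (((2 * R + 2 : ℕ) : ℝ) + ((d / 2 + 1 : ℕ) : ℝ)) * (CΔ * A𝒫 * A⁻¹))) + 16 * Real.exp (3 / 8) * hamNorm (fieldWt h (L : ℝ) d k) ((L : ℝ) ^ k) (L ^ (d * k)) (H - H') + CΔ) * (ω * A ^ 4)) * (((2 * (2 * κ * max 1 A𝒫)) ^ ((2 ^ (d + 1) + 2) ^ d * L ^ d) * (4 : ℝ) ^ ((2 ^ (d + 1) + 2) ^ d * L ^ d)) ^ (blocks (L * L ^ k) U).card * A ^ (-((1 + 1 / ((2 * (2 ^ d + 1) + 6 : ℝ) ^ d)) * (blocks (L * L ^ k) U).card) : ℝ))) := by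
  set P := abkmNormParams L N Mord R p r₀ h θbar A (schedDelta δ₀ δ₁ N) 𝒞 with hP
  set W := abkmWeightData L N Mord R θbar (schedDelta δ₀ δ₁ N) 𝒞 with hW
  have hd2 : 2 ≤ d := by omega
  have hL0 : (0 : ℝ) < L := by exact_mod_cast hLodd.pos
  have hA0 : 0 < A := by linarith
  have hk1 : k + 1 ≤ N + 1 := by omega
  have h𝔥 : 0 < fieldWt h (L : ℝ) d k := fieldWt_pos hh hL0 d k
  have hRk : (0 : ℝ) < (L : ℝ) ^ k := by positivity
  have hnn : ∀ G : RelevantHamiltonian ℂ d, 0 ≤ hamNorm (fieldWt h (L : ℝ) d k) ((L : ℝ) ^ k) (L ^ (d * k)) G :=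
    fun G => hamNorm_nonneg h𝔥.le hRk.le _ _
  have hb0 : 0 ≤ b := (hnn H).trans hH
  have hC87_0 : 0 ≤ pi2BoundConst d (((2 * R + 2 : ℕ) : ℝ) + ((d / 2 + 1 : ℕ) : ℝ)) := pi2BoundConst_nonneg d (by positivity)
  have hAinv : 0 ≤ A⁻¹ := inv_nonneg.2 hA0.le
  have hv0 : 0 ≤ pi2BoundConst d (((2 * R + 2 : ℕ) : ℝ) + ((d / 2 + 1 : ℕ) : ℝ)) * (C * A𝒫 * A⁻¹) := by positivity
  have hvΔ0 : 0 ≤ pi2BoundConst d (((2 * R + 2 : ℕ) : ℝ) + ((d / 2 + 1 : ℕ) : ℝ)) * (CΔ * A𝒫 * A⁻¹) := by positivity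
  have hnHH0 := hnn (H - H')
  have he38 : 0 ≤ 16 * Real.exp (3 / 8) := by positivity
  have he14 : 0 ≤ 8 * Real.exp (1 / 4) := by positivity
  have hHt0 := hamNorm_nextH_abkm_le hd2 hn hLodd hL hM hkN hp1 hpR hr₀2 hθbar hlam hB hh hCα hh2 hA1 D hD𝒞 hB₀ hc₀ H
    hC hK hKd hKloc
  have hHt'0 := hamNorm_nextH_abkm_le hd2 hn hLodd hL hM hkN hp1 hpR hr₀2 hθbar hlam hB hh hCα hh2 hA1 D hD𝒞 hB₀ hc₀ H'
    hC hK' hK'd hK'loc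
  have hΔle := hamNorm_nextH_sub_abkm_le hd2 hn hLodd hL hM hkN hp1 hpR hr₀2 hθbar hlam hB hh hCα hh2 hA1 D hD𝒞 hB₀ hc₀
    H H' hC hC hCΔ hK hK' hΔ hKd hK'd hKloc hK'loc
  have hHt : hamNorm (fieldWt h (L : ℝ) d k) ((L : ℝ) ^ k) (L ^ (d * k)) (nextH D H K) ≤ (2 * b + pi2BoundConst d (((2 * R + 2 : ℕ) : ℝ) + ((d / 2 + 1 : ℕ) : ℝ)) * (C * A𝒫 * A⁻¹)) := by
    linarith [hHt0, hH]
  have hHt' : hamNorm (fieldWt h (L : ℝ) d k) ((L : ℝ) ^ k) (L ^ (d * k)) (nextH D H' K') ≤ (2 * b + pi2BoundConst d (((2 * R + 2 : ℕ) : ℝ) + ((d / 2 + 1 : ℕ) : ℝ)) * (C * A𝒫 * A⁻¹)) := by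
    linarith [hHt'0, hH']
  have hτ : (2 * b + pi2BoundConst d (((2 * R + 2 : ℕ) : ℝ) + ((d / 2 + 1 : ℕ) : ℝ)) * (C * A𝒫 * A⁻¹)) ≤ 1 / 16 := by linarith [hb, hv]
  have hτ0 : 0 ≤ (2 * b + pi2BoundConst d (((2 * R + 2 : ℕ) : ℝ) + ((d / 2 + 1 : ℕ) : ℝ)) * (C * A𝒫 * A⁻¹)) := by positivity
  have hΔt : 16 * Real.exp (3 / 8) * hamNorm (fieldWt h (L : ℝ) d k) ((L : ℝ) ^ k) (L ^ (d * k)) (nextH D H K - nextH D H' K') ≤ 16 * Real.exp (3 / 8) * (2 * hamNorm (fieldWt h (L : ℝ) d k) ((L : ℝ) ^ k) (L ^ (d * k)) (H - H') + pi2BoundConst d (((2 * R + 2 : ℕ) : ℝ) + ((d / 2 + 1 : ℕ) : ℝ)) * (CΔ * A𝒫 * A⁻¹)) :=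
    mul_le_mul_of_nonneg_left hΔle he38
  have hκ : 1 + Real.exp (1 / 4) + 16 * Real.exp (3 / 8) * hamNorm (fieldWt h (L : ℝ) d k) ((L : ℝ) ^ k) (L ^ (d * k)) (nextH D H K - nextH D H' K') ≤ κ := by
    linarith [hΔt, hκ1]
  have hκ0 : 0 ≤ κ := by
    have e1 : 0 ≤ 16 * Real.exp (3 / 8) * hamNorm (fieldWt h (L : ℝ) d k) ((L : ℝ) ^ k) (L ^ (d * k)) (nextH D H K - nextH D H' K') := mul_nonneg he38 (hnn _)
    linarith [hκ, Real.exp_pos (1 / 4)]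
  have hκm0 : 0 ≤ κ ^ (blocks (L ^ k) U).card := pow_nonneg hκ0 _
  have hDP0 : 0 ≤ 16 * Real.exp (3 / 8) * (2 * hamNorm (fieldWt h (L : ℝ) d k) ((L : ℝ) ^ k) (L ^ (d * k)) (H - H') + pi2BoundConst d (((2 * R + 2 : ℕ) : ℝ) + ((d / 2 + 1 : ℕ) : ℝ)) * (CΔ * A𝒫 * A⁻¹)) := by positivity
  have hH16 : hamNorm (fieldWt h (L : ℝ) d k) ((L : ℝ) ^ k) (L ^ (d * k)) H ≤ 1 / 16 := by linarith [hH, hb]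
  have hH'16 : hamNorm (fieldWt h (L : ℝ) d k) ((L : ℝ) ^ k) (L ^ (d * k)) H' ≤ 1 / 16 := by linarith [hH', hb]
  have hθω : 8 * Real.exp (1 / 4) * (2 * b + pi2BoundConst d (((2 * R + 2 : ℕ) : ℝ) + ((d / 2 + 1 : ℕ) : ℝ)) * (C * A𝒫 * A⁻¹)) + 16 * Real.exp (3 / 8) * hamNorm (fieldWt h (L : ℝ) d k) ((L : ℝ) ^ k) (L ^ (d * k)) (nextH D H K - nextH D H' K') ≤ ω := by
    linarith [hΔt, hω1]
  have hbω : 8 * Real.exp (1 / 4) * hamNorm (fieldWt h (L : ℝ) d k) ((L : ℝ) ^ k) (L ^ (d * k)) H ≤ ω := by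
    have e1 := mul_le_mul_of_nonneg_left hH he14
    have e2 : 0 ≤ 16 * Real.exp (3 / 8) * hamNorm (fieldWt h (L : ℝ) d k) ((L : ℝ) ^ k) (L ^ (d * k)) (H - H') := by positivity
    linarith [hω2]
  have hb'ω : 8 * Real.exp (1 / 4) * hamNorm (fieldWt h (L : ℝ) d k) ((L : ℝ) ^ k) (L ^ (d * k)) H' + 16 * Real.exp (3 / 8) * hamNorm (fieldWt h (L : ℝ) d k) ((L : ℝ) ^ k) (L ^ (d * k)) (H - H') ≤ ω := by
    have e1 := mul_le_mul_of_nonneg_left hH' he14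
    linarith [hω2]
  have hω0 : 0 ≤ ω := le_trans (by positivity) hω3
  have hωA4 : 0 ≤ ω * A ^ 4 := by positivity
  have hmax : 0 ≤ 2 * κ * max 1 A𝒫 := by positivity
  have hgain0 : 0 ≤ A ^ (-((1 + 1 / ((2 * (2 ^ d + 1) + 6 : ℝ) ^ d)) * (blocks (L * L ^ k) U).card) : ℝ) := Real.rpow_nonneg hA0.le _
  have hY3 : 0 ≤ ((2 * (2 * κ * max 1 A𝒫)) ^ ((2 ^ (d + 1) + 2) ^ d * L ^ d) * (4 : ℝ) ^ ((2 ^ (d + 1) + 2) ^ d * L ^ d)) ^ (blocks (L * L ^ k) U).card * A ^ (-((1 + 1 / ((2 * (2 ^ d + 1) + 6 : ℝ) ^ d)) * (blocks (L * L ^ k) U).card) : ℝ) := by positivity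
  have hY2 : 0 ≤ ((2 * κ * max 1 A𝒫) ^ ((2 ^ (d + 1) + 2) ^ d * L ^ d) * (2 : ℝ) ^ ((2 ^ (d + 1) + 2) ^ d * L ^ d)) ^ (blocks (L * L ^ k) U).card * A ^ (-((1 + 1 / ((2 * (2 ^ d + 1) + 6 : ℝ) ^ d)) * (blocks (L * L ^ k) U).card) : ℝ) := by positivity
  have h2 := tayNormLE_remainderThree_sub_abkm (p := p) (r₀ := r₀) hd hLodd hL hR2 hM hkN hp1 hMord hθbar hlam hB hδ₀
    hδ₁ hh hh0 hA𝒫 hA1 hU hUne hHt hHt' hτ hH16 hH'16 hC hCΔ hK hK' hΔ hKfac hK0 hKd hK'fac hK'0 hK'd hKloc hK'loc hθω hbω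
    hb'ω hω3 hωA hκ
  exact h2.mono
    (by
      gcongr) (fun φ => (W.weight_pos (k + 1) U φ).le)

/-- **`Σ` (Four) in final form**: `tayNormLE_remainderFour_sub_abkm` for `H̃ = nextH D H K`, `H̃' = nextH D H' K'`, with
`‖H̃ − H̃'‖ ≤ 2‖H−H'‖ + v_Δ`, `‖H̃‖,‖H̃'‖ ≤ 2b + v` substituted (NextHamiltonianBounds).
[cite: AdamsBuchholzKoteckyMuller2019, Theorem 6.8 / Lemma 9.6 (proof, first order)] -/
theorem tayNormLE_remainderFour_sub_abkm_final {L N Mord R n p r₀ : ℕ} {θbar lam μ δ₁ δ₀ A𝒫 h A : ℝ}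
    {𝒞 : ℕ → (Fin d → ZMod M) → ℝ} (hd : 3 ≤ d) (hn : 2 ≤ n) (hLodd : Odd L) (hL : 2 ^ (d + 3) + 16 * R ≤ L)
    (hR2 : 2 ≤ R) (hM : M = L ^ N) {k : ℕ} (hkN : k + 1 ≤ N)
    (hp1 : d / 2 + 1 ≤ p) (hpR : p ≤ R) (hMord : d / 2 + 1 ≤ Mord) (hr₀2 : 2 ≤ r₀)
    (hθbar : 0 < θbar) (hlam : 0 < lam)
    (hB : AbkmWeightBounds L N Mord R n θbar lam μ δ₁ δ₀ A𝒫 𝒞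
      (abkmWeightData L N Mord R θbar (schedDelta δ₀ δ₁ N) 𝒞))
    (hδ₀ : 0 < δ₀) (hδ₁ : 0 < δ₁) (hh : 0 < h) (hh0 : hZeroSq d R δ₀ δ₁ ≤ h ^ 2)
    {Cα : (Fin d → ℕ) → ℝ}
    (hCα : ∀ j, 1 ≤ j → j ≤ N + 1 → ∀ θ' : Fin d → ℕ, ∑ i, θ' i ≤ n →
      ∀ x, |iterDiff θ' (𝒞 j) x| ≤ Cα θ' / (L : ℝ) ^ ((j - 1) * (d - 2 + ∑ i, θ' i)))
    (hh2 : secondDiffConst Cα ≤ h ^ 2) (hA𝒫 : 0 ≤ A𝒫) (hA1 : 1 ≤ A)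
    (D : StepData d M) (hD𝒞 : D.𝒞 = 𝒞 (k + 1))
    {x₀ : Fin d → ZMod M} (hB₀ : D.B₀ = blockOf (L ^ k) x₀) (hc₀ : D.c₀ = boxCorner (L ^ k) (starRad R L d k) x₀)
    {U : Finset (Fin d → ZMod M)} (hU : IsPolymer (L ^ (k + 1)) U)
    {H H' : RelevantHamiltonian ℂ d} {b : ℝ}
    (hH : hamNorm (fieldWt h (L : ℝ) d k) ((L : ℝ) ^ k) (L ^ (d * k)) H ≤ b)
    (hH' : hamNorm (fieldWt h (L : ℝ) d k) ((L : ℝ) ^ k) (L ^ (d * k)) H' ≤ b) (hb : b ≤ 1 / 64)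
    {K K' : Finset (Fin d → ZMod M) → ((Fin d → ZMod M) → ℝ) → ℂ} {C CΔ : ℝ} (hC : 0 ≤ C) (hCΔ : 0 ≤ CΔ)
    (hK : WeakNormLE (abkmNormParams L N Mord R p r₀ h θbar A (schedDelta δ₀ δ₁ N) 𝒞) k K C)
    (hK' : WeakNormLE (abkmNormParams L N Mord R p r₀ h θbar A (schedDelta δ₀ δ₁ N) 𝒞) k K' C)
    (hΔ : WeakNormLE (abkmNormParams L N Mord R p r₀ h θbar A (schedDelta δ₀ δ₁ N) 𝒞) k (K - K') CΔ)
    (hKfac : Factorises (L ^ k) K) (hK0 : ∀ φ, K ∅ φ = 1) (hK'fac : Factorises (L ^ k) K') (hK'0 : ∀ φ, K' ∅ φ = 1)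
    (hKd : ∀ Y, ContDiff ℝ r₀ (K Y)) (hK'd : ∀ Y, ContDiff ℝ r₀ (K' Y))
    (hKloc : ∀ Y, IsPolymer (L ^ k) Y → IsConn Y → IsGaugeLocal ((abkmNormParams L N Mord R p r₀ h θbar A (schedDelta δ₀ δ₁ N) 𝒞).gauge k Y) (K Y))
    (hK'loc : ∀ Y, IsPolymer (L ^ k) Y → IsConn Y → IsGaugeLocal ((abkmNormParams L N Mord R p r₀ h θbar A (schedDelta δ₀ δ₁ N) 𝒞).gauge k Y) (K' Y))
    (hv : pi2BoundConst d (((2 * R + 2 : ℕ) : ℝ) + ((d / 2 + 1 : ℕ) : ℝ)) * (C * A𝒫 * A⁻¹) ≤ 1 / 64)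
    {ω : ℝ}
    (hω1 : 8 * Real.exp (1 / 4) * (2 * b + pi2BoundConst d (((2 * R + 2 : ℕ) : ℝ) + ((d / 2 + 1 : ℕ) : ℝ)) * (C * A𝒫 * A⁻¹)) + 16 * Real.exp (3 / 8) * (2 * hamNorm (fieldWt h (L : ℝ) d k) ((L : ℝ) ^ k) (L ^ (d * k)) (H - H') + pi2BoundConst d (((2 * R + 2 : ℕ) : ℝ) + ((d / 2 + 1 : ℕ) : ℝ)) * (CΔ * A𝒫 * A⁻¹)) ≤ ω)
    (hω2 : 8 * Real.exp (1 / 4) * b + 16 * Real.exp (3 / 8) * hamNorm (fieldWt h (L : ℝ) d k) ((L : ℝ) ^ k) (L ^ (d * k)) (H - H') ≤ ω)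
    (hω3 : C + CΔ ≤ ω) (hωA : ω * A ^ 2 ≤ 1)
    {κ : ℝ}
    (hκ1 : 1 + Real.exp (1 / 4) + 16 * Real.exp (3 / 8) * (2 * hamNorm (fieldWt h (L : ℝ) d k) ((L : ℝ) ^ k) (L ^ (d * k)) (H - H') + pi2BoundConst d (((2 * R + 2 : ℕ) : ℝ) + ((d / 2 + 1 : ℕ) : ℝ)) * (CΔ * A𝒫 * A⁻¹)) ≤ κ) :
    TayNormLE ((abkmNormParams L N Mord R p r₀ h θbar A (schedDelta δ₀ δ₁ N) 𝒞).gauge (k + 1) U) r₀ ((abkmWeightData L N Mord R θbar (schedDelta δ₀ δ₁ N) 𝒞).weight (k + 1) U)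
      (fun φ => ∑ X ∈ ((polys (L ^ k) univ).filter (fun X => reblock (L ^ k) (L * L ^ k) X = U)),
        ∑ X₁ ∈ ((polys (L ^ k) X).erase X).erase ∅,
        (bprod (L ^ k) (fun B => expNegH (nextH D H K) B φ) (U \ X) * bprod (L ^ k) (fun B => expNegH (-(nextH D H K)) B φ) (X \ U) *
            (bprod (L ^ k) (fun B => 1 - expNegH (nextH D H K) B φ) X₁ * fluct (𝒞 (k + 1)) (polyP2 (L ^ k) H K (X \ X₁)) φ) -
          bprod (L ^ k) (fun B => expNegH (nextH D H' K') B φ) (U \ X) * bprod (L ^ k) (fun B => expNegH (-(nextH D H' K')) B φ) (X \ U) *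
            (bprod (L ^ k) (fun B => 1 - expNegH (nextH D H' K') B φ) X₁ * fluct (𝒞 (k + 1)) (polyP2 (L ^ k) H' K' (X \ X₁)) φ)))
      (κ ^ (blocks (L ^ k) U).card * ((3 * (16 * Real.exp (3 / 8) * (2 * hamNorm (fieldWt h (L : ℝ) d k) ((L : ℝ) ^ k) (L ^ (d * k)) (H - H') + pi2BoundConst d (((2 * R + 2 : ℕ) : ℝ) + ((d / 2 + 1 : ℕ) : ℝ)) * (CΔ * A𝒫 * A⁻¹))) + 16 * Real.exp (3 / 8) * hamNorm (fieldWt h (L : ℝ) d k) ((L : ℝ) ^ k) (L ^ (d * k)) (H - H') + CΔ) * (ω * A ^ 4)) * (((2 * (2 * κ * max 1 A𝒫)) ^ ((2 ^ (d + 1) + 2) ^ d * L ^ d) * (4 : ℝ) ^ ((2 ^ (d + 1) + 2) ^ d * L ^ d)) ^ (blocks (L * L ^ k) U).card * A ^ (-((1 + 1 / ((2 * (2 ^ d + 1) + 6 : ℝ) ^ d)) * (blocks (L * L ^ k) U).card) : ℝ))) := by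
  set P := abkmNormParams L N Mord R p r₀ h θbar A (schedDelta δ₀ δ₁ N) 𝒞 with hP
  set W := abkmWeightData L N Mord R θbar (schedDelta δ₀ δ₁ N) 𝒞 with hW
  have hd2 : 2 ≤ d := by omega
  have hL0 : (0 : ℝ) < L := by exact_mod_cast hLodd.pos
  have hA0 : 0 < A := by linarith
  have hk1 : k + 1 ≤ N + 1 := by omega
  have h𝔥 : 0 < fieldWt h (L : ℝ) d k := fieldWt_pos hh hL0 d k
  have hRk : (0 : ℝ) < (L : ℝ) ^ k := by positivity
  have hnn : ∀ G : RelevantHamiltonian ℂ d, 0 ≤ hamNorm (fieldWt h (L : ℝ) d k) ((L : ℝ) ^ k) (L ^ (d * k)) G :=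
    fun G => hamNorm_nonneg h𝔥.le hRk.le _ _
  have hb0 : 0 ≤ b := (hnn H).trans hH
  have hC87_0 : 0 ≤ pi2BoundConst d (((2 * R + 2 : ℕ) : ℝ) + ((d / 2 + 1 : ℕ) : ℝ)) := pi2BoundConst_nonneg d (by positivity)
  have hAinv : 0 ≤ A⁻¹ := inv_nonneg.2 hA0.le
  have hv0 : 0 ≤ pi2BoundConst d (((2 * R + 2 : ℕ) : ℝ) + ((d / 2 + 1 : ℕ) : ℝ)) * (C * A𝒫 * A⁻¹) := by positivity
  have hvΔ0 : 0 ≤ pi2BoundConst d (((2 * R + 2 : ℕ) : ℝ) + ((d / 2 + 1 : ℕ) : ℝ)) * (CΔ * A𝒫 * A⁻¹) := by positivity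
  have hnHH0 := hnn (H - H')
  have he38 : 0 ≤ 16 * Real.exp (3 / 8) := by positivity
  have he14 : 0 ≤ 8 * Real.exp (1 / 4) := by positivity
  have hHt0 := hamNorm_nextH_abkm_le hd2 hn hLodd hL hM hkN hp1 hpR hr₀2 hθbar hlam hB hh hCα hh2 hA1 D hD𝒞 hB₀ hc₀ H
    hC hK hKd hKloc
  have hHt'0 := hamNorm_nextH_abkm_le hd2 hn hLodd hL hM hkN hp1 hpR hr₀2 hθbar hlam hB hh hCα hh2 hA1 D hD𝒞 hB₀ hc₀ H'
    hC hK' hK'd hK'loc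
  have hΔle := hamNorm_nextH_sub_abkm_le hd2 hn hLodd hL hM hkN hp1 hpR hr₀2 hθbar hlam hB hh hCα hh2 hA1 D hD𝒞 hB₀ hc₀
    H H' hC hC hCΔ hK hK' hΔ hKd hK'd hKloc hK'loc
  have hHt : hamNorm (fieldWt h (L : ℝ) d k) ((L : ℝ) ^ k) (L ^ (d * k)) (nextH D H K) ≤ (2 * b + pi2BoundConst d (((2 * R + 2 : ℕ) : ℝ) + ((d / 2 + 1 : ℕ) : ℝ)) * (C * A𝒫 * A⁻¹)) := by
    linarith [hHt0, hH]
  have hHt' : hamNorm (fieldWt h (L : ℝ) d k) ((L : ℝ) ^ k) (L ^ (d * k)) (nextH D H' K') ≤ (2 * b + pi2BoundConst d (((2 * R + 2 : ℕ) : ℝ) + ((d / 2 + 1 : ℕ) : ℝ)) * (C * A𝒫 * A⁻¹)) := by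
    linarith [hHt'0, hH']
  have hτ : (2 * b + pi2BoundConst d (((2 * R + 2 : ℕ) : ℝ) + ((d / 2 + 1 : ℕ) : ℝ)) * (C * A𝒫 * A⁻¹)) ≤ 1 / 16 := by linarith [hb, hv]
  have hτ0 : 0 ≤ (2 * b + pi2BoundConst d (((2 * R + 2 : ℕ) : ℝ) + ((d / 2 + 1 : ℕ) : ℝ)) * (C * A𝒫 * A⁻¹)) := by positivity
  have hΔt : 16 * Real.exp (3 / 8) * hamNorm (fieldWt h (L : ℝ) d k) ((L : ℝ) ^ k) (L ^ (d * k)) (nextH D H K - nextH D H' K') ≤ 16 * Real.exp (3 / 8) * (2 * hamNorm (fieldWt h (L : ℝ) d k) ((L : ℝ) ^ k) (L ^ (d * k)) (H - H') + pi2BoundConst d (((2 * R + 2 : ℕ) : ℝ) + ((d / 2 + 1 : ℕ) : ℝ)) * (CΔ * A𝒫 * A⁻¹)) :=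
    mul_le_mul_of_nonneg_left hΔle he38
  have hκ : 1 + Real.exp (1 / 4) + 16 * Real.exp (3 / 8) * hamNorm (fieldWt h (L : ℝ) d k) ((L : ℝ) ^ k) (L ^ (d * k)) (nextH D H K - nextH D H' K') ≤ κ := by
    linarith [hΔt, hκ1]
  have hκ0 : 0 ≤ κ := by
    have e1 : 0 ≤ 16 * Real.exp (3 / 8) * hamNorm (fieldWt h (L : ℝ) d k) ((L : ℝ) ^ k) (L ^ (d * k)) (nextH D H K - nextH D H' K') := mul_nonneg he38 (hnn _)
    linarith [hκ, Real.exp_pos (1 / 4)]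
  have hκm0 : 0 ≤ κ ^ (blocks (L ^ k) U).card := pow_nonneg hκ0 _
  have hDP0 : 0 ≤ 16 * Real.exp (3 / 8) * (2 * hamNorm (fieldWt h (L : ℝ) d k) ((L : ℝ) ^ k) (L ^ (d * k)) (H - H') + pi2BoundConst d (((2 * R + 2 : ℕ) : ℝ) + ((d / 2 + 1 : ℕ) : ℝ)) * (CΔ * A𝒫 * A⁻¹)) := by positivity
  have hH16 : hamNorm (fieldWt h (L : ℝ) d k) ((L : ℝ) ^ k) (L ^ (d * k)) H ≤ 1 / 16 := by linarith [hH, hb]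
  have hH'16 : hamNorm (fieldWt h (L : ℝ) d k) ((L : ℝ) ^ k) (L ^ (d * k)) H' ≤ 1 / 16 := by linarith [hH', hb]
  have hθω : 8 * Real.exp (1 / 4) * (2 * b + pi2BoundConst d (((2 * R + 2 : ℕ) : ℝ) + ((d / 2 + 1 : ℕ) : ℝ)) * (C * A𝒫 * A⁻¹)) + 16 * Real.exp (3 / 8) * hamNorm (fieldWt h (L : ℝ) d k) ((L : ℝ) ^ k) (L ^ (d * k)) (nextH D H K - nextH D H' K') ≤ ω := by
    linarith [hΔt, hω1]
  have hbω : 8 * Real.exp (1 / 4) * hamNorm (fieldWt h (L : ℝ) d k) ((L : ℝ) ^ k) (L ^ (d * k)) H ≤ ω := by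
    have e1 := mul_le_mul_of_nonneg_left hH he14
    have e2 : 0 ≤ 16 * Real.exp (3 / 8) * hamNorm (fieldWt h (L : ℝ) d k) ((L : ℝ) ^ k) (L ^ (d * k)) (H - H') := by positivity
    linarith [hω2]
  have hb'ω : 8 * Real.exp (1 / 4) * hamNorm (fieldWt h (L : ℝ) d k) ((L : ℝ) ^ k) (L ^ (d * k)) H' + 16 * Real.exp (3 / 8) * hamNorm (fieldWt h (L : ℝ) d k) ((L : ℝ) ^ k) (L ^ (d * k)) (H - H') ≤ ω := by
    have e1 := mul_le_mul_of_nonneg_left hH' he14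
    linarith [hω2]
  have hω0 : 0 ≤ ω := le_trans (by positivity) hω3
  have hωA4 : 0 ≤ ω * A ^ 4 := by positivity
  have hmax : 0 ≤ 2 * κ * max 1 A𝒫 := by positivity
  have hgain0 : 0 ≤ A ^ (-((1 + 1 / ((2 * (2 ^ d + 1) + 6 : ℝ) ^ d)) * (blocks (L * L ^ k) U).card) : ℝ) := Real.rpow_nonneg hA0.le _
  have hY3 : 0 ≤ ((2 * (2 * κ * max 1 A𝒫)) ^ ((2 ^ (d + 1) + 2) ^ d * L ^ d) * (4 : ℝ) ^ ((2 ^ (d + 1) + 2) ^ d * L ^ d)) ^ (blocks (L * L ^ k) U).card * A ^ (-((1 + 1 / ((2 * (2 ^ d + 1) + 6 : ℝ) ^ d)) * (blocks (L * L ^ k) U).card) : ℝ) := by positivity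
  have hY2 : 0 ≤ ((2 * κ * max 1 A𝒫) ^ ((2 ^ (d + 1) + 2) ^ d * L ^ d) * (2 : ℝ) ^ ((2 ^ (d + 1) + 2) ^ d * L ^ d)) ^ (blocks (L * L ^ k) U).card * A ^ (-((1 + 1 / ((2 * (2 ^ d + 1) + 6 : ℝ) ^ d)) * (blocks (L * L ^ k) U).card) : ℝ) := by positivity
  have h2 := tayNormLE_remainderFour_sub_abkm (p := p) (r₀ := r₀) hd hLodd hL hR2 hM hkN hp1 hMord hθbar hlam hB hδ₀
    hδ₁ hh hh0 hA𝒫 hA1 hU hHt hHt' hτ hH16 hH'16 hC hCΔ hK hK' hΔ hKfac hK0 hKd hK'fac hK'0 hK'd hKloc hK'loc hθω hbω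
    hb'ω hω3 hωA hκ
  exact h2.mono
    (by
      gcongr) (fun φ => (W.weight_pos (k + 1) U φ).le)

end Literature.MathematicalPhysics.StatisticalMechanics.GradientRG

end
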